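import Literature.Analysis.FluidPDE.SereginSverakPressureLocalTypeI
import HarnessLib

/-!
# Route FrozenSignCascade · crux `BoundedEnvelopeContinuation` — stub C: backward boundedness at
# final-time points from a critical Morrey bound (the Seregin–Šverák zoom)

Helper file for the crux item stmt-NavierStokesRegularity-10579 (`BoundedEnvelopeContinuation`,
conjunct (B) of route `FrozenSignCascade`); lands `--supports` that item (stub
`stub_backwardBoundedOfMorrey` of the registered line).

* `exists_zoom_typeIBound_lt_top_of_morrey` — for a classical solution on `[0, T)` (viscosity
  `ν > 0`), Leray–Hopf on `[0, T)` from `u 0`, whose time slices obey the scale-invariant local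
  energy (critical Morrey) bound `∫_{B_r(x₁)} ‖u t‖² ≤ M r` for a.e. `t ∈ (0, T)` and all balls
  with `17 r ≤ 1`, and any `x₀`: the viscosity-normalising parabolic zoom `v = α u ∘ Φ`,
  `π = α² q ∘ Φ` about `(T, x₀)` (`Φ(s, y) = (T + βs, x₀ + Ry)`, `α = R/ν`, `β = R²/ν`, `q` Tao's
  gauge of the pressure) is a suitable weak solution of the unit-viscosity system in the parabolic
  ball `Q(0, 1)` (Albritton–Barker 2019, Def. 2.1) whose Type I quantity on `Q(0, 1/2)` is finite.
  This is the tree's `SereginSverak2002.exists_zoom_typeIBound_lt_top`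
  (`Literature/Analysis/FluidPDE/SereginSverakPressureLocalTypeI.lean`) with its Step 1
  (`ae_energy_ball_le`, the only use of the one-sided pressure hypothesis there) replaced by the
  Morrey hypothesis; the rest of the proof is transplanted verbatim.
* `stub_backwardBoundedOfMorrey` — consequently, if no suitable weak solution of the unforced
  unit-viscosity system has a local Type I singular point (`¬ LocalTypeISingularityExists`, the
  registered open statement of `LocalTypeI.lean`), such a solution is backward bounded at every
  final-time point `(T, x₀)`: otherwise the origin would be a backward singular point of the zoom
  (`SereginSverak2002.isBackwardBoundedAt_of_zoom`), hence a local Type I singular point.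

## References

* D. Albritton, T. Barker, J. Math. Fluid Mech. 21 (2019) = arXiv:1811.00502, Thm. 1.1, Def. 2.1,
  Lemma 2.6. [AlbrittonBarker2019]
* G. Seregin, V. Šverák, Arch. Ration. Mech. Anal. 163 (2002) 65–86, §2. [SereginSverak2002]
* G. Seregin, V. Šverák, Comm. Partial Differential Equations 34 (2009) 171–201 =
  arXiv:0804.1803, §2 (the parabolic zoom at a Type I point). [SereginSverak2009]
* G. Seregin, J. Math. Sci. 143 (2007) = arXiv:math/0607537, Lemma 2.1 (c). [Seregin2006]
-/

noncomputable section

set_option linter.dupNamespace false -- nested layout Summit.<S>.<Sub>, Sub = S (D-0017)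

open Set Filter Topology MeasureTheory
open scoped ContDiff

namespace Summit.NavierStokesRegularity.NavierStokesRegularity.Theorems.BoundedEnvelope

open Literature.Analysis.FluidPDE Literature.Analysis.FluidPDE.SereginSverak2002 InnerProductSpace
  Function TopologicalSpace Metric
open scoped RealInnerProductSpace ENNReal NNReal

-- adapted from Literature/Analysis/FluidPDE/SereginSverakPressureLocalTypeI.lean
-- (`SereginSverak2002.exists_zoom_typeIBound_lt_top`: Step 1 `ae_energy_ball_le` replaced by the
-- Morrey hypothesis `hMorrey`, everything else verbatim)

/-- **The viscosity-normalising zoom about a final-time point is locally Type I under a critical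
Morrey bound.** For a classical solution on `[0, T)` (viscosity `ν > 0`) which is Leray–Hopf on
`[0, T)` and whose slices satisfy `∫_{B_r(x₁)} ‖u t‖² ≤ M₀ r` for a.e. `t ∈ (0, T)`, all `x₁` and
all `0 < r ≤ 1/17`, and any `x₀`, there are `R, α, β > 0` such that, with the gauged pressure
`q = p − c(t)` and `Φ(s, y) = (T + βs, x₀ + Ry)`, the pair `v = α u ∘ Φ`, `π = α² q ∘ Φ` is a
suitable weak solution of the unit-viscosity system in the parabolic ball `Q(0, 1)`
(Albritton–Barker Def. 2.1) whose Type I quantity on `Q(0, 1/2)` is finite: `𝐈(Q(0, 1/2)) < ⊤`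
(the scaled energies `A` on all parabolic sub-balls of `Q(0,1)` are bounded by the Morrey bound
transported along `Φ`, and `C, D, E` by the tree's `albrittonBarker2019_lemma_2_6_holds`,
Seregin 2006). [cite: AlbrittonBarker2019, Lemma 2.6 and Def. 2.1] -/
theorem exists_zoom_typeIBound_lt_top_of_morrey {ν T : ℝ}
    {u : ℝ → EuclideanSpace ℝ (Fin 3) → EuclideanSpace ℝ (Fin 3)}
    {p : ℝ → EuclideanSpace ℝ (Fin 3) → ℝ}
    (hν : 0 < ν) (hT : 0 < T)
    (hsol : IsClassicalNSSolutionOn (Ico 0 T) ν 0 u p) (hLH : IsLerayHopfOn T ν 0 (u 0) u)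
    (hMorrey : ∃ M₀ : ℝ, ∀ᵐ t ∂(volume.restrict (Ioo 0 T)), ∀ (x₁ : EuclideanSpace ℝ (Fin 3))
      (r : ℝ), 0 < r → 17 * r ≤ 1 → ∫ x in ball x₁ r, ‖u t x‖ ^ 2 ≤ M₀ * r)
    (x₀ : EuclideanSpace ℝ (Fin 3)) :
    ∃ R α β : ℝ, 0 < R ∧ 0 < α ∧ 0 < β ∧ β = R ^ 2 / ν ∧ α = R / ν ∧ β ≤ T ∧
      IsSuitableWeakSolutionInBall 1 0 (α • stPull β R T x₀ u)
        (α ^ 2 • stPull β R T x₀ fun t x => p t x - (p t 0 - normalisedPressure (u t) 0)) ∧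
      HasWeakSpatialGradientOn (parabolicCylinderOpens 1 (0 : ℝ × EuclideanSpace ℝ (Fin 3)))
        (α • stPull β R T x₀ u)
        ((α * R) • stPull β R T x₀ fun t x => fderiv ℝ (u t) x) ∧
      typeIBound (parabolicCylinder (1 / 2) (0 : ℝ × EuclideanSpace ℝ (Fin 3)))
        (α • stPull β R T x₀ u)
        (α ^ 2 • stPull β R T x₀ fun t x => p t x - (p t 0 - normalisedPressure (u t) 0))
        ((α * R) • stPull β R T x₀ fun t x => fderiv ℝ (u t) x) < ⊤ := by
  -- Step 1: the scaled energy bound for a.e. slice (hypothesis)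
  obtain ⟨M₀, hM₀⟩ := hMorrey
  set M : ℝ := max M₀ 0 with hMdef
  have hM0 : 0 ≤ M := le_max_right _ _
  have hM : ∀ᵐ t ∂(volume.restrict (Ioo 0 T)), ∀ (x₁ : EuclideanSpace ℝ (Fin 3)) (r : ℝ), 0 < r →
      17 * r ≤ 1 → ∫ x in ball x₁ r, ‖u t x‖ ^ 2 ≤ M * r := by
    filter_upwards [hM₀] with t ht x₁ r hr hr17
    exact (ht x₁ r hr hr17).trans (mul_le_mul_of_nonneg_right (le_max_left _ _) hr.le)
  -- scales: `R ≤ 1/17`, `R² / ν ≤ T`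
  set R : ℝ := min (1 / 17) (Real.sqrt (ν * T)) with hR
  have hRpos : 0 < R := lt_min (by norm_num) (Real.sqrt_pos.2 (by positivity))
  have hR17 : R ≤ 1 / 17 := min_le_left _ _
  set α : ℝ := R / ν with hα
  set β : ℝ := R ^ 2 / ν with hβdef
  have hαpos : 0 < α := by positivity
  have hβpos : 0 < β := by positivity
  have hβeq : β = α * R := by rw [hβdef, hα]; field_simp
  have hβT : β ≤ T := by
    have h1 : R ≤ Real.sqrt (ν * T) := min_le_right _ _
    have h2 : R ^ 2 ≤ ν * T := by
      have := pow_le_pow_left₀ hRpos.le h1 2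
      rwa [Real.sq_sqrt (by positivity)] at this
    rw [hβdef, div_le_iff₀ hν]; linarith
  refine ⟨R, α, β, hRpos, hαpos, hβpos, rfl, rfl, hβT, ?_⟩
  -- the gauged pressure
  set q : ℝ → EuclideanSpace ℝ (Fin 3) → ℝ :=
    fun t x => p t x - (p t 0 - normalisedPressure (u t) 0) with hq
  -- the `ν`-cylinder `(T - β, T) × B(x₀, R)` inside the slab, and its preimage `Q(0,1)`
  set PO : Opens (ℝ × EuclideanSpace ℝ (Fin 3)) :=
    ⟨Ioo (T - β) T ×ˢ ball x₀ R, isOpen_Ioo.prod isOpen_ball⟩ with hPO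
  have hPOslab :
      (PO : Set (ℝ × EuclideanSpace ℝ (Fin 3))) ⊆
        Ioo 0 T ×ˢ (univ : Set (EuclideanSpace ℝ (Fin 3))) := by
    rintro ⟨t, x⟩ ⟨ht, -⟩
    exact ⟨⟨by linarith [ht.1], ht.2⟩, mem_univ _⟩
  have hpre1 :
      stPreimage β R T x₀ PO = parabolicCylinderOpens 1 (0 : ℝ × EuclideanSpace ℝ (Fin 3)) := by
    apply Opens.ext
    rw [coe_stPreimage]
    have h := stAffine_preimage_cylinder_eq_parabolicCylinder hν hRpos T x₀ R
    rw [div_self hRpos.ne'] at h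
    exact h
  -- suitability of the zoom on `Q(0,1)` with unit viscosity
  have hsuit1 :
      IsSuitableWeakSolutionOn (parabolicCylinderOpens 1 (0 : ℝ × EuclideanSpace ℝ (Fin 3))) 1 0
        (α • stPull β R T x₀ u) (α ^ 2 • stPull β R T x₀ q) := by
    have h0 := (isSuitableWeakSolutionOn_gauge_of_classical hν hT hsol hLH PO hPOslab).stRescale
      hαpos hRpos hβeq T x₀
    have hvisc : α * ν / R = 1 := by rw [hα, div_mul_cancel₀ R hν.ne', div_self hRpos.ne']
    have hforce :
        ((α ^ 2 * R) • stPull β R T x₀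
          (0 : ℝ → EuclideanSpace ℝ (Fin 3) → EuclideanSpace ℝ (Fin 3))) = 0 := by
      funext s y; simp [stPull]
    rw [hvisc, hforce, hpre1] at h0
    exact h0
  -- the zoomed classical gradient
  have hGu : HasWeakSpatialGradientOn PO u fun t x => fderiv ℝ (u t) x :=
    hasWeakSpatialGradientOn_of_contDiffOn isOpen_Ioo hPOslab
      ((classical_Ioo hsol).smooth_velocity.of_le (by norm_cast))
  have hGv : HasWeakSpatialGradientOn (parabolicCylinderOpens 1 (0 : ℝ × EuclideanSpace ℝ (Fin 3)))
      (α • stPull β R T x₀ u) ((α * R) • stPull β R T x₀ fun t x => fderiv ℝ (u t) x) := by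
    rw [← hpre1]
    exact hGu.stRescale α hβpos hRpos T x₀
  -- the class `IsSuitableWeakSolutionInBall 1 0`
  have hball :
      IsSuitableWeakSolutionInBall 1 0 (α • stPull β R T x₀ u) (α ^ 2 • stPull β R T x₀ q) := by
    refine ⟨hsuit1, ?_, ⟨_, hGv, ?_⟩, ?_⟩
    · -- energy class
      set CE : ENNReal := ENNReal.ofReal (2 * VectorCalculus.kineticEnergy (u 0)) with hCE
      have hphys : ∀ᵐ t ∂(volume.restrict (Ioo (T + β * (-1)) (T + β * 0))),
          ∫⁻ x in ball x₀ R, ‖u t x‖ₑ ^ 2 ≤ CE := by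
        refine (ae_restrict_mem measurableSet_Ioo).mono fun t ht => ?_
        have htI : t ∈ Icc 0 T :=
          ⟨by nlinarith [ht.1], by have := ht.2; simp at this; exact this.le⟩
        exact (setLIntegral_le_lintegral _ _).trans (eEnergy_le hν.le hLH htI)
      have h2 := ae_sliced_setLIntegral_ball_stRescale hβpos hRpos T x₀ x₀ R (-1) 0
        (fun t x => ‖u t x‖ₑ ^ 2) hphys
      rw [finrank_euclideanSpace_fin, sub_self, smul_zero, div_self hRpos.ne'] at h2
      set C₁ : ENNReal := ‖α‖ₑ ^ 2 * (ENNReal.ofReal (R ^ 3)⁻¹ * CE) with hC₁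
      have hC₁top : C₁ ≠ ⊤ :=
        ENNReal.mul_ne_top (by simp)
          (ENNReal.mul_ne_top ENNReal.ofReal_ne_top ENNReal.ofReal_ne_top)
      refine ⟨C₁.toNNReal, ?_⟩
      rw [ENNReal.coe_toNNReal hC₁top]
      have hset :
          Ioo ((0 : ℝ × EuclideanSpace ℝ (Fin 3)).1 - 1 ^ 2) (0 : ℝ × EuclideanSpace ℝ (Fin 3)).1 =
            Ioo (-1 : ℝ) 0 := by
        simp
      rw [hset]
      filter_upwards [h2] with s hs
      have e : ∀ y : EuclideanSpace ℝ (Fin 3), ‖(α • stPull β R T x₀ u) s y‖ₑ ^ 2 =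
          ‖α‖ₑ ^ 2 * ‖u (T + β * s) (x₀ + R • y)‖ₑ ^ 2 := by
        intro y
        rw [smul_stPull_apply, enorm_smul, mul_pow]
      simp only [e]
      rw [lintegral_const_mul' _ _ (by simp)]
      exact mul_le_mul' le_rfl hs
    · -- `∫_{Q(0,1)} |∇v|² < ⊤`
      have hpre : parabolicCylinder 1 (0 : ℝ × EuclideanSpace ℝ (Fin 3)) =
          stAffine β R T x₀ ⁻¹' (Ioo (T - (R * 1) ^ 2 / ν) T ×ˢ ball x₀ (R * 1)) := by
        rw [hβdef, stAffine_preimage_cylinder_eq_parabolicCylinder hν hRpos T x₀ (R * 1),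
          mul_div_cancel_left₀ (1 : ℝ) hRpos.ne']
        rfl
      rw [hpre, setLIntegral_frobeniusNormSq_stRescale hβpos hRpos T x₀ (α * R),
        finrank_euclideanSpace_fin]
      refine ENNReal.mul_lt_top (ENNReal.mul_lt_top ENNReal.ofReal_lt_top ENNReal.ofReal_lt_top) ?_
      refine lt_of_le_of_lt (lintegral_mono_set ?_)
        (lintegral_slab_frobeniusNormSq_fderiv_lt_top' hsol hLH)
      rw [mul_one]
      rintro ⟨t, x⟩ ⟨ht, -⟩
      refine ⟨⟨?_, ht.2⟩, mem_univ _⟩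
      have : R ^ 2 / ν = β := rfl
      linarith [ht.1]
    · -- `π ∈ L^{3/2}(Q(0,1))`
      refine ⟨hsuit1.distributional.2.2.1.aestronglyMeasurable, ?_⟩
      have h32 : ((3 : ENNReal) / 2).toReal = 3 / 2 := by rw [ENNReal.toReal_div]; norm_num
      have h32top : (3 : ENNReal) / 2 ≠ ⊤ := (ENNReal.div_lt_top (by simp) (by simp)).ne
      rw [eLpNorm_eq_lintegral_rpow_enorm_toReal (by norm_num) h32top, h32]
      refine ENNReal.rpow_lt_top_of_nonneg (by positivity) (ne_of_lt ?_)
      have hQ1 : parabolicCylinder 1 (0 : ℝ × EuclideanSpace ℝ (Fin 3)) =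
          stAffine β R T x₀ ⁻¹' (PO : Set (ℝ × EuclideanSpace ℝ (Fin 3))) := by
        rw [← coe_stPreimage, hpre1]; rfl
      rw [hQ1]
      show ∫⁻ z in stAffine β R T x₀ ⁻¹' (PO : Set (ℝ × EuclideanSpace ℝ (Fin 3))),
          ‖(α ^ 2 • stPull β R T x₀ q) z.1 z.2‖ₑ ^ (3 / 2 : ℝ) < ⊤
      rw [setLIntegral_enorm_rpow_stRescale hβpos hRpos T x₀ (α ^ 2) q _ (by norm_num)]
      refine ENNReal.mul_lt_top (ENNReal.mul_lt_top
        (ENNReal.rpow_lt_top_of_nonneg (by norm_num) enorm_ne_top) ENNReal.ofReal_lt_top) ?_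
      exact lt_of_le_of_lt (lintegral_mono_set hPOslab)
        (lintegral_slab_gauged_pressure_lt_top hν hT hsol hLH)
  -- the scaled energies `A` on every parabolic sub-ball of `Q(0,1)`
  set Abd : ENNReal := ‖α‖ₑ ^ 2 * (ENNReal.ofReal (R ^ 3)⁻¹ * ENNReal.ofReal (M * R)) with hAbd
  have hAbdtop : Abd < ⊤ := ENNReal.mul_lt_top (by simp)
    (ENNReal.mul_lt_top ENNReal.ofReal_lt_top ENNReal.ofReal_lt_top)
  have hA : ∀ (r : ℝ), 0 < r → ∀ (z : ℝ × EuclideanSpace ℝ (Fin 3)),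
      parabolicCylinder r z ⊆ parabolicCylinder 1 (0 : ℝ × EuclideanSpace ℝ (Fin 3)) →
      cknAEss r z (α • stPull β R T x₀ u) ≤ Abd := by
    intro r hr z hz
    obtain ⟨-, -, ht1, ht2, -⟩ := parabolicCylinder_subset_data hr hz
    simp only [Prod.fst_zero, one_pow, zero_sub] at ht1 ht2
    have hr1 : r ≤ 1 := by nlinarith
    have hRr : R * r ≤ 1 / 17 := by nlinarith
    have hsubT : Ioo (T + β * (z.1 - r ^ 2)) (T + β * z.1) ⊆ Ioo 0 T := by
      intro t ht
      constructor
      · nlinarith [ht.1]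
      · nlinarith [ht.2]
    have hphys : ∀ᵐ t ∂(volume.restrict (Ioo (T + β * (z.1 - r ^ 2)) (T + β * z.1))),
        ∫⁻ x in ball (x₀ + R • z.2) (R * r), ‖u t x‖ₑ ^ 2 ≤ ENNReal.ofReal (M * (R * r)) := by
      refine ae_restrict_of_ae_restrict_of_subset hsubT ?_
      filter_upwards [hM, ae_restrict_mem measurableSet_Ioo] with t ht htI
      have hb := ht (x₀ + R • z.2) (R * r) (by positivity) (by linarith)
      have hint : IntegrableOn (fun x => ‖u t x‖ ^ 2) (ball (x₀ + R • z.2) (R * r)) :=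
        ((hLH.memLp t ⟨htI.1.le, htI.2.le⟩).integrable_norm_pow two_ne_zero).integrableOn
      have e : ∫⁻ x in ball (x₀ + R • z.2) (R * r), ‖u t x‖ₑ ^ 2 =
          ENNReal.ofReal (∫ x in ball (x₀ + R • z.2) (R * r), ‖u t x‖ ^ 2) := by
        rw [ofReal_integral_eq_lintegral_ofReal hint (Eventually.of_forall fun x => by positivity)]
        refine lintegral_congr fun x => ?_
        rw [← ofReal_norm, ENNReal.ofReal_pow (norm_nonneg _)]
      rw [e]
      exact ENNReal.ofReal_le_ofReal hb
    have h2 := ae_sliced_setLIntegral_ball_stRescale hβpos hRpos T x₀ (x₀ + R • z.2) (R * r)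
      (z.1 - r ^ 2) z.1 (fun t x => ‖u t x‖ₑ ^ 2) hphys
    rw [finrank_euclideanSpace_fin, add_sub_cancel_left, smul_smul, inv_mul_cancel₀ hRpos.ne',
      one_smul, mul_div_cancel_left₀ r hRpos.ne'] at h2
    refine essSup_le_of_ae_le _ ?_
    filter_upwards [h2] with s hs
    have e : ∀ y : EuclideanSpace ℝ (Fin 3), ‖(α • stPull β R T x₀ u) s y‖ₑ ^ 2 =
        ‖α‖ₑ ^ 2 * ‖u (T + β * s) (x₀ + R • y)‖ₑ ^ 2 := by
      intro y
      rw [smul_stPull_apply, enorm_smul, mul_pow]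
    simp only [e]
    rw [lintegral_const_mul' _ _ (by simp)]
    have hr0 : ENNReal.ofReal r ≠ 0 := (ENNReal.ofReal_pos.2 hr).ne'
    calc (ENNReal.ofReal r)⁻¹ * (‖α‖ₑ ^ 2 *
          ∫⁻ y in ball z.2 r, ‖u (T + β * s) (x₀ + R • y)‖ₑ ^ 2)
        ≤ (ENNReal.ofReal r)⁻¹ * (‖α‖ₑ ^ 2 *
            (ENNReal.ofReal (R ^ 3)⁻¹ * ENNReal.ofReal (M * (R * r)))) :=
          mul_le_mul' le_rfl (mul_le_mul' le_rfl hs)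
      _ = Abd := by
          rw [hAbd, show M * (R * r) = (M * R) * r by ring,
            ENNReal.ofReal_mul (by positivity : (0:ℝ) ≤ M * R)]
          rw [show (ENNReal.ofReal r)⁻¹ * (‖α‖ₑ ^ 2 * (ENNReal.ofReal (R ^ 3)⁻¹ *
              (ENNReal.ofReal (M * R) * ENNReal.ofReal r))) =
              ‖α‖ₑ ^ 2 * (ENNReal.ofReal (R ^ 3)⁻¹ * ENNReal.ofReal (M * R)) *
                ((ENNReal.ofReal r)⁻¹ * ENNReal.ofReal r) by ring,
            ENNReal.inv_mul_cancel hr0 ENNReal.ofReal_ne_top, mul_one]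
  have hAsup : (⨆ (r : ℝ) (_ : 0 < r) (z' : ℝ × EuclideanSpace ℝ (Fin 3))
      (_ : parabolicCylinder r z' ⊆ parabolicCylinder 1 (0 : ℝ × EuclideanSpace ℝ (Fin 3))),
        cknAEss r z' (α • stPull β R T x₀ u)) < ⊤ := by
    refine lt_of_le_of_lt ?_ hAbdtop
    exact iSup_le fun r => iSup_le fun hr => iSup_le fun z' => iSup_le fun hz' => hA r hr z' hz'
  exact ⟨hball, hGv, albrittonBarker2019_lemma_2_6_holds 0 _ _ hball _ hGv (Or.inl hAsup) (1 / 2)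
    (by norm_num) (by norm_num)⟩

-- adapted from Literature/Analysis/FluidPDE/SereginSverakPressureLocalTypeI.lean
-- (`seregin_sverak_2002_of_not_localTypeISingularityExists`, final block)

/-- **Stub C of the registered line of the crux `BoundedEnvelopeContinuation`: backward
boundedness at final-time points from a critical Morrey bound, given that no local Type I
singular point exists.** If no suitable weak solution of the unforced unit-viscosity system has a
Type I singular point in the sense of Albritton–Barker 2019, Thm. 1.1
(`¬ LocalTypeISingularityExists`), then a classical solution on `[0, T)` (viscosity `ν > 0`),
Leray–Hopf on `[0, T)` from `u 0`, whose slices obey the scale-invariant local energy bound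
`∫_{B_r(x₁)} ‖u t‖² ≤ M r` for a.e. `t ∈ (0, T)` and all balls with `17 r ≤ 1`, is backward
bounded at every final-time point `(T, x₀)`: by `exists_zoom_typeIBound_lt_top_of_morrey` the
viscosity-normalising zoom about `(T, x₀)` is a suitable weak solution in `Q(0, 1)` with finite
Type I quantity on `Q(0, 1/2)`, and were `u` unbounded near `(T, x₀)` the origin would be a
backward singular point of the zoom (`SereginSverak2002.isBackwardBoundedAt_of_zoom`), i.e. a
local Type I singular point.
[cite: SereginSverak2009, §2; AlbrittonBarker2019, Thm. 1.1 and Lemma 2.6] -/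
theorem stub_backwardBoundedOfMorrey :
    ¬ Literature.Analysis.FluidPDE.LocalTypeISingularityExists →
      ∀ ν T : ℝ, 0 < ν → 0 < T →
        ∀ (u : ℝ → EuclideanSpace ℝ (Fin 3) → EuclideanSpace ℝ (Fin 3))
          (p : ℝ → EuclideanSpace ℝ (Fin 3) → ℝ),
          Literature.Analysis.FluidPDE.IsClassicalNSSolutionOn (Set.Ico 0 T) ν 0 u p →
          Literature.Analysis.FluidPDE.IsLerayHopfOn T ν 0 (u 0) u →
          (∃ M : ℝ, ∀ᵐ t ∂(MeasureTheory.volume.restrict (Set.Ioo 0 T)),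
              ∀ (x₁ : EuclideanSpace ℝ (Fin 3)) (r : ℝ), 0 < r → 17 * r ≤ 1 →
                ∫ x in Metric.ball x₁ r, ‖u t x‖ ^ 2 ≤ M * r) →
          ∀ x₀ : EuclideanSpace ℝ (Fin 3),
            Literature.Analysis.FluidPDE.IsBackwardBoundedAt u T x₀ := by
  intro hno ν T hν hT u p hsol hLH hM x₀
  obtain ⟨R, α, β, hR, hα, hβ, -, -, hβT, hball, hGv, htypeI⟩ :=
    exists_zoom_typeIBound_lt_top_of_morrey hν hT hsol hLH hM x₀
  by_contra hnot
  apply hno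
  have hsing :
      IsBackwardSingularPoint (α • stPull β R T x₀ u) (0 : ℝ × EuclideanSpace ℝ (Fin 3)) := by
    intro r hr
    by_contra hfin
    have hfin' : eLpNorm (uncurry (α • stPull β R T x₀ u)) ⊤
        (volume.restrict (parabolicCylinder (min r 1) (0 : ℝ × EuclideanSpace ℝ (Fin 3)))) < ⊤ := by
      refine lt_of_le_of_lt (eLpNorm_mono_measure _ (Measure.restrict_mono ?_ le_rfl))
        (lt_top_iff_ne_top.2 hfin)
      exact SuitableCompactness.parabolicCylinder_zero_mono (le_min hr.le zero_le_one)
        (min_le_left _ _)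
    exact hnot (isBackwardBoundedAt_of_zoom hsol x₀ hR hα hβ hβT (lt_min hr one_pos)
      (min_le_right _ _) hfin')
  refine ⟨1 / 2, 0, α • stPull β R T x₀ u,
    α ^ 2 • stPull β R T x₀ (fun t x => p t x - (p t 0 - normalisedPressure (u t) 0)),
    by norm_num, ?_, hsing, _,
    hGv.mono (SuitableCompactness.parabolicCylinderOpens_zero_mono (by norm_num) (by norm_num)),
    htypeI⟩
  exact SuitableCompactness.isSuitableWeakSolutionInBall_of_le_radius hball (by norm_num)
    (by norm_num)

end Summit.NavierStokesRegularity.NavierStokesRegularity.Theorems.BoundedEnvelope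

end
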